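import Summits.HodgeConjecture.HodgeConjecture.Theorems.Ring2AbelianAllAndreWeilBlockOneEntry
import HarnessLib

/-!
# Ring 2 · sub-cell AbelianAll (ALL ABELIAN VARIETIES), André axis, part XLII-a — CONJUGATE CORRESPONDENCES: complex conjugation
# commutes with the complex-orientation Gysin maps; every algebraic correspondence has an algebraic conjugate and a real decomposition

HONEST FRAMING (page 1, verbatim): **research route, not a corollary; conditional on HC_CM plus one named
minimal statement.** Cell line: research route conditional on HC_CM; not a corollary; Q11.4-sentence-2
already refuted in dim ≥ 3. Nothing in this file proves a case of the Hodge conjecture for an abelian variety, nor `B(X)` for a new `X`;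
`HC_CM` (`Theses.RankFourFaces.CMAbelianHodge`) does not occur in this file; item `Theses.RankFourFaces.CMToAbelian` (stmt-16267)
OPEN and not closed here. Seat `pub-hodge-ring2-ab-andre-2`, gen 34; brief (iii) "state the smallest open instance as a find-the-cycle
problem; partial results as theorems".

Part XLI-f proved: ONE non-zero Weil-block entry of the fibre trace of ONE algebraic `M : H^{k+2}(𝒳) → Hᵏ(𝒳)` gives β at `t`, GRANTED a
conjugate-linear involution `cj` of `Hᵏ(X_t)` commuting with `φ_t^*` and with the fibre trace `j_t^* M j_{t*}` — hypotheses, true in the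
habitat for a cycle with REAL class. THIS FILE supplies the conjugation and its commutation rules on the tree's carriers; part XLII-b
(`Ring2AbelianAllAndreWeilPlaneMoves`) then removes every conjugation hypothesis from the criterion. (§2) Complex conjugation `conjClass` of
`H•(–(ℂ); ℂ) = H•(–; ℝ) ⊗ ℂ` commutes with pull-backs (tree: `conjClass_map`; **`conjClass_map_complexBetti`**), with the Gysin morphisms of
the COMPLEX orientation family (they preserve rational classes, which are real and span — **`conjClass_complexGysin_complexOrientation`**,
the statement of the tree's `LefschetzStandardB.conjClass_complexGysin`, re-derived in ten lines to keep this axis's import cone free of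
that file's closure) and hence with correspondence actions up to conjugating the class (**`conjClass_corrAction_complexOrientation`**).
Consequently (**`IsAlgebraicCorrespondence.exists_conj`**) EVERY algebraic correspondence `T` (André's "donnée par une correspondance
algébrique", complex coefficients allowed) has an algebraic CONJUGATE `T^c` with `conj ∘ T = T^c ∘ conj` (`T^c = [conj γ]_*`, and `conj γ`
is algebraic: `conjClass_mem_algebraicClasses`), and (**`IsAlgebraicCorrespondence.exists_real_decomposition`**) a decomposition
`T = T₁ + i T₂` into algebraic correspondences COMMUTING with conjugation — the real structure of the space of algebraic correspondences
on the carriers. (§3) Fibre traces conjugate accordingly: `conj ∘ (j_t^* M j_{t*}) = (j_t^* M^c j_{t*}) ∘ conj` (**`conjClass_fibreTrace`**),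
and `φ_t^*` commutes with conjugation (**`conjClass_fibreEndo`**). (§1) The two-operator forms of XLI-f's entry symmetries
(**`lagrange_entry_conj_swap₂`** / **`_diag₂`**: the `(c,b)` entry of `v'` is the conjugate of the `(b,c)` entry of `v` when `cj ∘ v = v' ∘ cj`),
and the eigenvalue bookkeeping **`conj_eigenvalues_of_swap`**: if a real operator `F` has eigenlines `x_a, x_b, x_c = cj x_b` with distinct
eigenvalues and `cj x_a ∈ ℂx_a + ℂx_b + ℂx_c`, then `conj a = a`, `conj b = c`, `conj c = b` — so NO hypothesis on the eigenvalues survives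
in part XLII-b.

HONEST STATUS. Elementary (Voisin I Cor. 6.12 + the tree's rational structure of `H•` and of the Gysin maps + part XXII-e); not located
in print in this form; claimed only as a formal object. GAP: none closed; N104 untouched; no cycle is produced.
References: VoisinHodgeI2002 (§6.1.3 Cor. 6.12, §7.3.2); Andre1996Motifs (§2.1); Fulton1998 (§16.1); GrothendieckTopology1969 (§1);
vanGeemen1994HodgeAV (5.2); DeningerMurre1991 (3.1); FultonYoungTableaux1997 (App. B).
-/

noncomputable section

set_option linter.dupNamespace false

namespace Summit.HodgeConjecture.HodgeConjecture.Ring2.AbelianAll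

open CategoryTheory CategoryTheory.Limits AlgebraicGeometry MonoidalCategory CartesianMonoidalCategory
open Literature.AlgebraicGeometry Literature.AlgebraicGeometry.Motives
open Literature.AlgebraicGeometry.HodgeTheory
open Literature.AlgebraicTopology.SingularHomology (singularCohomology cupProduct)
open Summit.HodgeConjecture.HodgeConjecture.Theorems (deg_fiberGysin_aux)

/-! ## §1 Linear algebra: two-operator entry symmetries and the eigenvalues under a conjugation -/

section Conj

variable {V : Type*} [AddCommGroup V] [Module ℂ V]

/-- **Anti-diagonal entries of conjugate operators are conjugate**: for a conjugate-linear involution `cj` commuting with `T`,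
intertwining `v` and `v'` (`cj ∘ v = v' ∘ cj`), with `conj a = a`, `conj b = c`, `conj c = b` and `cj x_b = x_c`:
`L_c (v' x_b) = cj (L_b (v x_c))` (part XLI-f's `lagrange_entry_conj_swap` is the case `v = v'`). [cite: VoisinHodgeI2002, §6.1.3 Cor. 6.12] [folklore] -/
theorem lagrange_entry_conj_swap₂ (cj : V →ₛₗ[starRingEnd ℂ] V) (hcc : ∀ x, cj (cj x) = x) (T v v' : V →ₗ[ℂ] V)
    (hcT : ∀ x, cj (T x) = T (cj x)) (hcv : ∀ x, cj (v x) = v' (cj x)) {a b c : ℂ}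
    (ha : starRingEnd ℂ a = a) (hb : starRingEnd ℂ b = c) (hc : starRingEnd ℂ c = b) {xb xc : V} (hx : cj xb = xc) :
    (((c - a) * (c - b))⁻¹ • (T ∘ₗ T - (a + b) • T + (a * b) • LinearMap.id) : V →ₗ[ℂ] V) (v' xb) =
      cj (((((b - a) * (b - c))⁻¹ • (T ∘ₗ T - (a + c) • T + (a * c) • LinearMap.id) : V →ₗ[ℂ] V) (v xc))) := by
  rw [conj_lagrange cj T hcT ha hb hc, hcv, ← hx, hcc]

/-- **Diagonal entries of conjugate operators are conjugate**: `L_c (v' x_c) = cj (L_b (v x_b))`. [cite: VoisinHodgeI2002, §6.1.3 Cor. 6.12] [folklore] -/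
theorem lagrange_entry_conj_diag₂ (cj : V →ₛₗ[starRingEnd ℂ] V) (T v v' : V →ₗ[ℂ] V)
    (hcT : ∀ x, cj (T x) = T (cj x)) (hcv : ∀ x, cj (v x) = v' (cj x)) {a b c : ℂ}
    (ha : starRingEnd ℂ a = a) (hb : starRingEnd ℂ b = c) (hc : starRingEnd ℂ c = b) {xb xc : V} (hx : cj xb = xc) :
    (((c - a) * (c - b))⁻¹ • (T ∘ₗ T - (a + b) • T + (a * b) • LinearMap.id) : V →ₗ[ℂ] V) (v' xc) =
      cj (((((b - a) * (b - c))⁻¹ • (T ∘ₗ T - (a + c) • T + (a * c) • LinearMap.id) : V →ₗ[ℂ] V) (v xb))) := by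
  rw [conj_lagrange cj T hcT ha hb hc, hcv, hx]

/-- **The eigenvalues of a real operator on three eigenlines exchanged by a conjugation.** Let `cj` be a conjugate-linear involution
commuting with `F`, and `x_a ≠ 0`, `x_b ≠ 0`, `x_c = cj x_b` eigenvectors of `F` with eigenvalues `a, b, c`, `a ≠ b`, `a ≠ c`, such that
`cj x_a ∈ ℂx_a + ℂx_b + ℂx_c`. Then `conj b = c`, `conj c = b` (apply `F` to `cj x_b = x_c`) and `conj a = a` (`cj x_a` is an eigenvector for
`conj a` in a space killed by `(F−a)(F−b)(F−c)`, and `conj a ∈ {b, c}` would force `a ∈ {c, b}`). In the Weil habitat: `N(k)^{p}` is real and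
`σ(k)^{2n}`, `σ̄(k)^{2n}` are conjugate — here DERIVED, not assumed. [cite: VoisinHodgeI2002, §6.1.3 Cor. 6.12] [cite: vanGeemen1994HodgeAV, proof of Lemma 5.2 (6)] -/
theorem conj_eigenvalues_of_swap (cj : V →ₛₗ[starRingEnd ℂ] V) (hcc : ∀ x, cj (cj x) = x) (F : V →ₗ[ℂ] V)
    (hcF : ∀ x, cj (F x) = F (cj x)) {a b c : ℂ} (hab : a ≠ b) (hac : a ≠ c) {xa xb xc : V}
    (hxa : F xa = a • xa) (hxb : F xb = b • xb) (hxc : F xc = c • xc) (ha0 : xa ≠ 0) (hb0 : xb ≠ 0) (hx : cj xb = xc)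
    {α β γ : ℂ} (hya : cj xa = α • xa + β • xb + γ • xc) :
    starRingEnd ℂ a = a ∧ starRingEnd ℂ b = c ∧ starRingEnd ℂ c = b := by
  have hc0 : xc ≠ 0 := by
    rw [← hx]
    intro h
    exact hb0 (by rw [← hcc xb, h, map_zero])
  have hb' : starRingEnd ℂ b = c := by
    have h1 : F xc = starRingEnd ℂ b • xc := by rw [← hx, ← hcF, hxb, LinearMap.map_smulₛₗ]
    exact smul_left_injective ℂ hc0 (h1.symm.trans hxc)
  have hc' : starRingEnd ℂ c = b := by rw [← hb', starRingEnd_self_apply]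
  refine ⟨?_, hb', hc'⟩
  have hy : F (cj xa) = starRingEnd ℂ a • cj xa := by rw [← hcF, hxa, LinearMap.map_smulₛₗ]
  have hy0 : cj xa ≠ 0 := fun h ↦ ha0 (by rw [← hcc xa, h, map_zero])
  -- `(F - a)(F - b)(F - c)` acts on an `e`-eigenvector by `(e-a)(e-b)(e-c)` and kills `ℂx_a + ℂx_b + ℂx_c`
  have key : ∀ {z : V} {e : ℂ}, F z = e • z →
      F (F (F z)) - (a + b + c) • F (F z) + (a * b + a * c + b * c) • F z - (a * b * c) • z = ((e - a) * (e - b) * (e - c)) • z := by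
    intro z e hz
    simp only [hz, map_smul, smul_smul]
    module
  have h1 := key hy
  have h2 : F (F (F (cj xa))) - (a + b + c) • F (F (cj xa)) + (a * b + a * c + b * c) • F (cj xa) - (a * b * c) • cj xa = 0 := by
    rw [hya]
    simp only [map_add, map_smul, hxa, hxb, hxc, smul_smul]
    module
  rw [h2] at h1
  rcases smul_eq_zero.1 h1.symm with h | h
  · rcases mul_eq_zero.1 h with h | h
    · rcases mul_eq_zero.1 h with h | h
      · exact sub_eq_zero.1 h
      · exact absurd (show a = c by rw [← hb', ← sub_eq_zero.1 h, starRingEnd_self_apply]) hac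
    · exact absurd (show a = b by rw [← hc', ← sub_eq_zero.1 h, starRingEnd_self_apply]) hab
  · exact absurd h hy0

end Conj

/-! ## §2 Conjugation commutes with the Gysin morphisms of the complex orientations; conjugate and real-part correspondences -/

section Real

variable {m n : ℕ} {W X Y : SchemeOver ℂ}

/-- `conj (g^* c) = g^* (conj c)` for the pull-back along a morphism of `ℂ`-schemes (the tree's `conjClass_map` for `g(ℂ)`, in the
`complexBetti.map` spelling). [cite: VoisinHodgeI2002, §6.1.3 Cor. 6.12] -/
theorem conjClass_map_complexBetti (g : X ⟶ Y) (k : ℕ) (c : complexBetti Y k) :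
    conjClass (ComplexPoints X) k ((complexBetti.map g k).hom c) = (complexBetti.map g k).hom (conjClass (ComplexPoints Y) k c) :=
  conjClass_map _ c

/-- **The Gysin morphisms of the complex orientation family commute with complex conjugation**: `conj (g_* w) = g_* (conj w)` for
`g : Y ⟶ X` of smooth projective varieties — `g_*` maps rational classes to rational classes (`isRationalClass_complexGysin_complexOrientationFamily`),
rational classes are real (`IsRationalClass.conjClass_eq`) and span `H•(Y(ℂ); ℂ)` (`span_isRationalClass_eq_top_of_isSmoothProjective_holds`).
Same statement and proof as the tree's `LefschetzStandardB.conjClass_complexGysin` (re-derived to keep this axis's imports light).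
[cite: VoisinHodgeI2002, §6.1.3 Cor. 6.12 and §7.3.2] -/
theorem conjClass_complexGysin_complexOrientation (hY : IsSmoothProjective m Y) (hX : IsSmoothProjective n X) (g : Y ⟶ X)
    {a b : ℕ} (hab : a + 2 * n = b + 2 * m) (w : complexBetti Y a) :
    conjClass (ComplexPoints X) b (complexGysin complexOrientationFamily hY hX g hab w) =
      complexGysin complexOrientationFamily hY hX g hab (conjClass (ComplexPoints Y) a w) := by
  have hw : w ∈ Submodule.span ℂ {c : complexBetti Y a | IsRationalClass c} := by
    rw [span_isRationalClass_eq_top_of_isSmoothProjective_holds m Y hY a]; trivial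
  induction hw using Submodule.span_induction with
  | mem c hc => rw [hc.conjClass_eq, (isRationalClass_complexGysin_complexOrientationFamily hY hX g hab hc).conjClass_eq]
  | zero => rw [conjClass_zero, map_zero, conjClass_zero]
  | add x y _ _ hx hy => rw [map_add, conjClass_add, hx, hy, conjClass_add, map_add]
  | smul r x _ hx => rw [map_smul, conjClass_smul, hx, conjClass_smul, map_smul]

/-- **`conj ([γ]_* u) = [conj γ]_* (conj u)`** for the correspondence action through the complex orientations (conjugation is natural,
multiplicative — `conjClass_cupProduct` — and commutes with `pr_{W*}`). Same statement as the tree's `LefschetzStandardB.conjClass_corrAction`.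
[cite: VoisinHodgeI2002, §6.1.3 Cor. 6.12 and §7.3.2] [cite: Fulton1998, §16.1] -/
theorem conjClass_corrAction_complexOrientation (hW : IsSmoothProjective m W) (hX : IsSmoothProjective n X) {e a b : ℕ}
    (hab : a + 2 * e = b + 2 * n) (γ : complexBetti (W ⊗ X) (2 * e)) (u : complexBetti X a) :
    conjClass (ComplexPoints W) b (corrAction complexOrientationFamily hW hX hab γ u) =
      corrAction complexOrientationFamily hW hX hab (conjClass (ComplexPoints (W ⊗ X)) (2 * e) γ)
        (conjClass (ComplexPoints X) a u) := by
  rw [corrAction_apply, corrAction_apply, conjClass_complexGysin_complexOrientation, conjClass_cupProduct, conjClass_map_complexBetti]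

/-- **EVERY ALGEBRAIC CORRESPONDENCE HAS AN ALGEBRAIC CONJUGATE**: for `T : Hᵃ(X(ℂ)) → Hᵇ(W(ℂ))` induced by an algebraic class (complex
coefficients: `T = [γ]_*`, `γ ∈ Nᵉ H^{2e}((W ⊗ X)(ℂ); ℂ)`, normalised to the complex orientations by part XXII-e) there is an algebraic
`T^c` with `conj (T x) = T^c (conj x)` — namely `[conj γ]_*`, `conj γ` being algebraic (`conjClass_mem_algebraicClasses`: `Nᵉ` is the
`ℂ`-span of its rational classes). For a REAL class `T^c = T`. [cite: VoisinHodgeI2002, §6.1.3 Cor. 6.12 and §7.3.2]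
[cite: Andre1996Motifs, §2.1 remark following Déf. 1 (p. 14)] [cite: GrothendieckTopology1969, §1 p. 299] -/
theorem IsAlgebraicCorrespondence.exists_conj (hW : IsSmoothProjective m W) (hX : IsSmoothProjective n X) {a b : ℕ}
    {T : complexBetti X a →ₗ[ℂ] complexBetti W b} (hT : IsAlgebraicCorrespondence m n W X T) :
    ∃ Tc : complexBetti X a →ₗ[ℂ] complexBetti W b, IsAlgebraicCorrespondence m n W X Tc ∧
      ∀ x, conjClass (ComplexPoints W) b (T x) = Tc (conjClass (ComplexPoints X) a x) := by
  have hb := IsAlgebraicCorrespondence.le_two_mul hT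
  obtain ⟨e, hab, γ, hγ, rfl⟩ := IsAlgebraicCorrespondence.exists_eq_corrAction hW hX hT
  exact ⟨corrAction complexOrientationFamily hW hX hab (conjClass (ComplexPoints (W ⊗ X)) (2 * e) γ),
    isAlgebraicCorrespondence_corrAction_complex hW hX hab hb (conjClass_mem_algebraicClasses (hW.tensor_holds hX) e hγ),
    fun x ↦ conjClass_corrAction_complexOrientation hW hX hab γ x⟩

/-- The conjugate relation is symmetric: `conj (T^c x) = T (conj x)` as well (`conj` is an involution). [folklore] -/
theorem conjClass_apply_of_conj {a b : ℕ} {T Tc : complexBetti X a →ₗ[ℂ] complexBetti W b}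
    (h : ∀ x, conjClass (ComplexPoints W) b (T x) = Tc (conjClass (ComplexPoints X) a x)) (x : complexBetti X a) :
    conjClass (ComplexPoints W) b (Tc x) = T (conjClass (ComplexPoints X) a x) := by
  have h' := h (conjClass (ComplexPoints X) a x)
  rw [conjClass_conjClass] at h'
  rw [← h', conjClass_conjClass]

/-- **THE REAL STRUCTURE OF ALGEBRAIC CORRESPONDENCES**: every algebraic `T : Hᵃ(X(ℂ)) → Hᵇ(W(ℂ))` is `T = T₁ + i·T₂` with `T₁, T₂`
algebraic AND commuting with complex conjugation (`T₁ = ½(T + T^c)`, `T₂ = (2i)⁻¹(T − T^c)`; part XXII-e: sums and scalars). So a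
non-vanishing linear functional of the fibre trace of SOME algebraic cycle is already non-zero on a cycle with conjugation-equivariant
action. [cite: VoisinHodgeI2002, §6.1.3 Cor. 6.12] [cite: Andre1996Motifs, §2.1 remark following Déf. 1 (p. 14)] -/
theorem IsAlgebraicCorrespondence.exists_real_decomposition (hW : IsSmoothProjective m W) (hX : IsSmoothProjective n X) {a b : ℕ}
    {T : complexBetti X a →ₗ[ℂ] complexBetti W b} (hT : IsAlgebraicCorrespondence m n W X T) :
    ∃ T₁ T₂ : complexBetti X a →ₗ[ℂ] complexBetti W b,
      IsAlgebraicCorrespondence m n W X T₁ ∧ IsAlgebraicCorrespondence m n W X T₂ ∧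
      (∀ x, conjClass (ComplexPoints W) b (T₁ x) = T₁ (conjClass (ComplexPoints X) a x)) ∧
      (∀ x, conjClass (ComplexPoints W) b (T₂ x) = T₂ (conjClass (ComplexPoints X) a x)) ∧
      T = T₁ + Complex.I • T₂ := by
  obtain ⟨Tc, algTc, hTc⟩ := IsAlgebraicCorrespondence.exists_conj hW hX hT
  have hTc' := conjClass_apply_of_conj hTc
  refine ⟨(2 : ℂ)⁻¹ • (T + Tc), (-Complex.I / 2) • (T - Tc), IsAlgebraicCorrespondence.smul hW hX (IsAlgebraicCorrespondence.add hW hX hT algTc) _,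
    IsAlgebraicCorrespondence.smul hW hX (IsAlgebraicCorrespondence.sub hW hX hT algTc) _,
    fun x ↦ ?_, fun x ↦ ?_, ?_⟩
  · simp only [LinearMap.smul_apply, LinearMap.add_apply, conjClass_smul, conjClass_add, hTc, hTc', map_inv₀, map_ofNat]
    module
  · have hsub : ∀ c c' : complexBetti W b, conjClass (ComplexPoints W) b (c - c') =
        conjClass (ComplexPoints W) b c - conjClass (ComplexPoints W) b c' := fun c c' ↦ (conjClassEquiv _ b).map_sub c c'
    simp only [LinearMap.smul_apply, LinearMap.sub_apply, conjClass_smul, hsub, hTc, hTc', map_div₀, map_neg, Complex.conj_I,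
      map_ofNat, neg_neg]
    module
  · have h : Complex.I * (-Complex.I / 2) = (2 : ℂ)⁻¹ := by
      rw [mul_div_assoc', mul_neg, Complex.I_mul_I, neg_neg, one_div]
    rw [smul_smul, h, ← smul_add, add_add_sub_cancel, ← two_smul ℂ T, smul_smul, inv_mul_cancel₀ (two_ne_zero' ℂ), one_smul]

end Real

variable {𝒳 S : SchemeOver ℂ} {d : ℕ} {f : 𝒳 ⟶ S} (hf : IsCompactAbelianPencil f d)

/-- `𝐆[hf, s, k]` — `j_{s*} : Hᵏ(X_s(ℂ); ℂ) → H^{k+2}(𝒳(ℂ); ℂ)` for the complex orientations (display notation, as in part XL-a).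
[cite: FultonYoungTableaux1997, Appendix B §B.1 (5)] -/
local notation3 (prettyPrint := false) "𝐆[" hf ", " s ", " k "]" =>
  complexGysin complexOrientationFamily (IsCompactAbelianPencil.isSmoothProjective_fiberOver hf s)
    (IsCompactAbelianPencil.isSmoothProjective_total hf) (fiberι f s) (deg_fiberGysin_aux k d)

/-- `𝐣[s, k]` — `j_s^* : Hᵏ(𝒳(ℂ); ℂ) → Hᵏ(X_s(ℂ); ℂ)` as a linear map (display notation). [cite: VoisinHodgeI2002, §7.3.2] -/
local notation3 (prettyPrint := false) "𝐣[" s ", " k "]" => (complexBetti.map (fiberι f s) k).hom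

/-- `𝐜[X, k]` — complex conjugation on `Hᵏ(X(ℂ); ℂ)` (display notation for the tree's `conjClass`). [cite: VoisinHodgeI2002, §6.1.3 Cor. 6.12] -/
local notation3 (prettyPrint := false) "𝐜[" X ", " k "]" => conjClass (ComplexPoints X) k

/-! ## §3 Fibre traces of conjugate correspondences -/

section FibreTrace

/-- **`conj ∘ (j_t^* M j_{t*}) = (j_t^* M^c j_{t*}) ∘ conj`**: the fibre trace of a correspondence and that of its conjugate are
intertwined by complex conjugation on the fibre (`j_t^*` and the complex-orientation `j_{t*}` commute with conjugation). For `M` with real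
class (`M^c = M`) the fibre trace COMMUTES with conjugation — the hypothesis `hcv` of part XLI-f. [cite: VoisinHodgeI2002, §6.1.3 Cor. 6.12 and §7.3.2] -/
theorem conjClass_fibreTrace (t : ComplexPoints S) {k : ℕ} (M Mc : complexBetti 𝒳 (k + 2) →ₗ[ℂ] complexBetti 𝒳 k)
    (hMc : ∀ y, 𝐜[𝒳, k] (M y) = Mc (𝐜[𝒳, k + 2] y)) (x : complexBetti (fiberOver f t) k) :
    𝐜[fiberOver f t, k] (𝐣[t, k] (M (𝐆[hf, t, k] x))) = 𝐣[t, k] (Mc (𝐆[hf, t, k] (𝐜[fiberOver f t, k] x))) := by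
  rw [conjClass_map_complexBetti, hMc, conjClass_complexGysin_complexOrientation]

/-- The `S`-endomorphism's fibre action `φ_t^*` commutes with conjugation (naturality). [cite: VoisinHodgeI2002, §6.1.3 Cor. 6.12] -/
theorem conjClass_fibreEndo (t : ComplexPoints S) {k : ℕ} (φt : fiberOver f t ⟶ fiberOver f t) (x : complexBetti (fiberOver f t) k) :
    𝐜[fiberOver f t, k] ((complexBetti.map φt k).hom x) = (complexBetti.map φt k).hom (𝐜[fiberOver f t, k] x) :=
  conjClass_map_complexBetti φt k x

end FibreTrace

end Summit.HodgeConjecture.HodgeConjecture.Ring2.AbelianAll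

end
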